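import Summits.Ventures.LatticeQCDFlow.Scaling.DominatedStarRegimeFreeGap

/-!
HONEST FRAMING: exact (Metropolis-corrected) sampling algorithms for lattice gauge theory; figures
of merit are autocorrelation/cost numbers at stated couplings and volumes; no continuum-physics
claim.

# DominatedStarRegimeFreeAutocorrelation — THE MAP-ASSISTED HUB WITH ENTRY MAPS IS IRREDUCIBLE AS SOON AS ITS HOT UPDATE IS,
# AND THE INTEGRATED AUTOCORRELATION TIME OF EVERY OBSERVABLE IS `τ_int(g) ≤ 1/(p·min{ct/(3m), γ₀(1−t)w_0/(7K)}) − ½` WITH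
# NO REGIME; EXACT HOT SAMPLER AT THE `p`-INDEPENDENT SWAP FRACTION `t = 1/2`, `w_0 = 1`, `m = cK`: `τ_int(g) ≤ 14K/p − ½` —
# OPEN-MATH ITEM 5 ANSWERED FOR AUTOCORRELATIONS (lean-2 GEN-28, ours)

Venture-side (OURS).  Cell `lqcd-flow` (pub-lqcd), unit `pub-lqcd-lean-2-g28`, 2026-08-28.  Chapter N, file 3.  The
variational gap of `Scaling/DominatedStarRegimeFreeGap` (N2) bounds the asymptotic variance of every observable once the
scheme is irreducible (Levin–Peres–Wilmer / Kipnis–Varadhan route of the tree, `tauInt_le_of_gapFloor`).  Chapter M obtained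
irreducibility from its mixing bound, hence only inside the regime (`Scaling/DominatedStarTimeAverages`, M11); here it is proved
directly by the closed-set criterion: the hot update moves the hub anywhere, and the rotation path of N1 (relabel the hub, swap
through the entry's own map, relabel back) moves every cold level anywhere.

## What is proved

* §1 **`entryStar_isIrreducible_of_hot`** — hub list `r ↦ (0, κ_r+1)` reaching every cold level, ENTRY maps `φ_r`, positive laws,
  `0 < t < 1`, `w ≥ 0`, `Σw = 1`, `w_0 > 0`, hot update irreducible, cold updates arbitrary: the scheme is irreducible;
  `exactSampler_isIrreducible`, **`dominatedStar_isIrreducible_regimeFree`** (the chapter-M scheme, exact hot sampler, multiplicities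
  `≥ c ≥ 1`; M11's `dominatedStar_isIrreducible` without `4t ≤ p(1−t)w_0`).
* §2 **`entryStar_tauInt_le`** — `τ_int(g) = asympVar(g)/(2Var(g)) ≤ 1/(p·min{ct/(3m), γ₀(1−t)w_0/(7K)}) − ½` for every
  non-constant `g` (hot update `μ_0`-reversible AND irreducible with Poincaré constant `γ₀`, cold updates `μ_k`-reversible);
  **`dominatedStar_tauInt_le_regimeFree`** — exact hot sampler: `τ_int(g) ≤ 1/(p·min{ct/(3m), (1−t)w_0/(7K)}) − ½`;
  **`dominatedStar_tauInt_le_half`** — `t = 1/2`: `τ_int(g) ≤ 1/(p·min{c/(6m), w_0/(14K)}) − ½`;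
  **`uniformStar_tauInt_le_half`** — `t = 1/2`, `w_0 = 1`, `m ≤ cK` (uniform listing): **`τ_int(g) ≤ 14K/p − ½`**.

Reading (no numerics implied): OPEN-MATH-chapterM item 5 asked whether `τ_int = Θ(m/(cp))` is achievable at a `p`-independent swap
fraction — under the regime the best rate was `Θ(p²c/m)` at `t = Θ(p)`.  For autocorrelations the answer is yes: at `t = 1/2` every
observable of the exact-hot-sampler hub with one-sided transports of quality `p` decorrelates within `14K/p` steps at uniform listing,
against the floor `2K·μ(A)μ(Aᶜ)/t − ½ = 4Kμ(A)μ(Aᶜ) − ½` of `Scaling/DominatedStarAutocorrelationLaw` (M16) for a sector indicator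
of an idle cold replica.  NOT CLAIMED: the same for the mixing time in total variation with a `log K` (item 1, open); sharp
constants; anything measured.  Literature grade (cell rule): OWN RESULT on N2 and the tree's closed-set criterion
(`isIrreducible_of_forall_closed`) and `τ_int`-from-gap lemma; nothing cited as a fact; no new bib keys.
-/

noncomputable section

open Finset Function
open Literature.Probability.MarkovChains

namespace Summit.Ventures.LatticeQCDFlow.Scaling

variable {S : Type*} [Fintype S] [DecidableEq S] {K m : ℕ} {μ : Fin (K + 1) → S → ℝ} {M : Fin (K + 1) → S → S → ℝ}
  {w : Fin (K + 1) → ℝ} {t p : ℝ}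

section EntryStar
variable (κ : Fin m → Fin K) (φ : Fin m → Equiv.Perm S)

/-! ## §1 Irreducibility from the hot update, with entry maps -/

/-- **THE MAP-ASSISTED HUB WITH ENTRY MAPS IS IRREDUCIBLE AS SOON AS THE HOT UPDATE IS** (every cold level has an entry,
positive laws, `0 < t < 1`, `w ≥ 0`, `Σw = 1`, `w_0 > 0`; cold updates arbitrary transition matrices): a closed set of
configurations is closed under hot moves (the hot update is irreducible), under every entry swap (positive acceptance), hence
under the rotation path `z ↦ z^{l←v}` of N1 — so it is everything. [ours] -/
theorem entryStar_isIrreducible_of_hot (hκ : ∀ k : Fin K, ∃ r, κ r = k) (hμ : ∀ k x, 0 < μ k x)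
    (hM : ∀ k, IsRowStochastic (M k)) (hM0 : Literature.Probability.MarkovChains.IsIrreducible (M 0))
    (hw0 : ∀ k, 0 ≤ w k) (hw1 : ∑ k, w k = 1) (hwhot : 0 < w 0) (ht0 : 0 < t) (ht1 : t < 1) :
    Literature.Probability.MarkovChains.IsIrreducible (fun x y : Fin (K + 1) → S =>
      t * ptGraphSwap μ (fun r : Fin m => (((0 : Fin (K + 1)), (κ r).succ) : Fin (K + 1) × Fin (K + 1))) φ x y
        + (1 - t) * prodKernel w M x y) := by
  set e : Fin m → Fin (K + 1) × Fin (K + 1) := fun r => (((0 : Fin (K + 1)), (κ r).succ) : Fin (K + 1) × Fin (K + 1)) with he_def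
  have he : ∀ r, (e r).1 ≠ (e r).2 := fun r => (Fin.succ_ne_zero (κ r)).symm
  have hQ := ptGraphSwap_isRowStochastic (e := e) (φ := φ) hμ
  have hP0 := (weightedScheme_isRowStochastic hQ hM hw0 hw1 ht0.le ht1.le).1
  refine isIrreducible_of_forall_closed hP0 fun T hT hcl => ?_
  -- (A) one move of the hot replica
  have moveA : ∀ (x : Fin (K + 1) → S) (v : S), x ∈ T → 0 < M 0 (x 0) v → update x 0 v ∈ T := by
    intro x v hx hv
    by_cases hvx : v = x 0
    · rw [hvx, update_eq_self]; exact hx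
    refine hcl x hx (update x 0 v) ?_
    have h := whub_hot_flow_ge (M := M) (w := w) (t := t) hQ.1 hμ ht0.le x hvx
    have hpos : 0 < (1 - t) * w 0 * (tensorFun μ x * M 0 (x 0) v) :=
      mul_pos (mul_pos (by linarith) hwhot) (mul_pos (tensorFun_pos hμ x) hv)
    exact (mul_pos_iff_of_pos_left (tensorFun_pos hμ x)).mp (lt_of_lt_of_le hpos h)
  -- (B) the whole hot coordinate, by irreducibility of the hot update
  have moveB : ∀ x : Fin (K + 1) → S, x ∈ T → ∀ v, update x 0 v ∈ T := by
    intro x hx v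
    set V : Finset S := univ.filter fun u => update x 0 u ∈ T with hV
    have hxk : x 0 ∈ V := by rw [hV, Finset.mem_filter, update_eq_self]; exact ⟨mem_univ _, hx⟩
    have hclV : ∀ u ∈ V, ∀ u', 0 < M 0 u u' → u' ∈ V := by
      intro u hu u' huu'
      rw [hV, Finset.mem_filter] at hu ⊢
      refine ⟨mem_univ _, ?_⟩
      have h := moveA (update x 0 u) u' hu.2 (by rwa [update_self])
      rwa [update_idem] at h
    have hVu := hM0.eq_univ_of_closed (hM 0).1 ⟨x 0, hxk⟩ hclV
    have hv : v ∈ V := by rw [hVu]; exact mem_univ _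
    rw [hV, Finset.mem_filter] at hv
    exact hv.2
  -- (C) every entry swap has positive probability
  have swapPos : ∀ (x : Fin (K + 1) → S) (r : Fin m), x ∈ T → edgeFlowSwap (φ r) 0 (κ r).succ x ∈ T := by
    intro x r hx
    by_cases hxr : edgeFlowSwap (φ r) 0 (κ r).succ x = x
    · rw [hxr]; exact hx
    refine hcl x hx _ ?_
    have hflow : tensorFun μ x * ptGraphSwap μ e φ x (edgeFlowSwap (φ r) 0 (κ r).succ x)
        = ptGraphProposal e φ x (edgeFlowSwap (φ r) 0 (κ r).succ x)
          * min (tensorFun μ x) (tensorFun μ (edgeFlowSwap (φ r) 0 (κ r).succ x)) :=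
      tensorFun_mul_ptGraphSwap hμ he hxr
    have hprop : (1 : ℝ) / m ≤ ptGraphProposal e φ x (edgeFlowSwap (φ r) 0 (κ r).succ x) :=
      ptGraphProposal_edge_ge e φ r x
    have hm0 : 0 < m := by have := r.2; omega
    have hsw : 0 < tensorFun μ x * ptGraphSwap μ e φ x (edgeFlowSwap (φ r) 0 (κ r).succ x) := by
      rw [hflow]
      exact mul_pos (lt_of_lt_of_le (div_pos one_pos (by exact_mod_cast hm0)) hprop)
        (lt_min (tensorFun_pos hμ _) (tensorFun_pos hμ _))
    have hsw' : 0 < ptGraphSwap μ e φ x (edgeFlowSwap (φ r) 0 (κ r).succ x) :=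
      (mul_pos_iff_of_pos_left (tensorFun_pos hμ x)).mp hsw
    have hpr : 0 ≤ prodKernel w M x (edgeFlowSwap (φ r) 0 (κ r).succ x) :=
      (prodKernel_isRowStochastic M w hw0 hw1 hM).1 _ _
    have : 0 < t * ptGraphSwap μ e φ x (edgeFlowSwap (φ r) 0 (κ r).succ x)
        + (1 - t) * prodKernel w M x (edgeFlowSwap (φ r) 0 (κ r).succ x) :=
      add_pos_of_pos_of_nonneg (mul_pos ht0 hsw') (mul_nonneg (by linarith) hpr)
    exact this
  -- (D) every coordinate, by the rotation path through an entry of its level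
  have moveD : ∀ (k : Fin (K + 1)) (x : Fin (K + 1) → S), x ∈ T → ∀ v, update x k v ∈ T := by
    intro k
    induction k using Fin.cases with
    | zero => exact moveB
    | succ l =>
      intro x hx v
      obtain ⟨r, hr⟩ := hκ l
      rw [← hr, update_eq_mapRotation x (Fin.succ_ne_zero (κ r)) (φ r) v]
      exact moveB _ (swapPos _ r (moveB x hx _)) _
  -- (E) everything
  obtain ⟨x₀, hx₀⟩ := hT
  have key : ∀ (y : Fin (K + 1) → S) (s : Finset (Fin (K + 1))), s.piecewise y x₀ ∈ T := by
    intro y s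
    induction s using Finset.induction_on with
    | empty => rwa [Finset.piecewise_empty]
    | insert k s hk ih =>
      rw [Finset.piecewise_insert]
      exact moveD k _ ih _
  refine Finset.eq_univ_of_forall fun y => ?_
  have h := key y univ
  rwa [Finset.piecewise_univ] at h

omit [DecidableEq S] in
/-- The exact hot sampler `M_0(u,·) = μ_0 > 0` is irreducible (one step). [ours] -/
theorem exactSampler_isIrreducible [DecidableEq S] (hμ : ∀ x, 0 < μ 0 x) (hM0 : ∀ u v, M 0 u v = μ 0 v) :
    Literature.Probability.MarkovChains.IsIrreducible (M 0) :=
  fun u v => ⟨1, by rw [pow_one, hM0]; exact hμ v⟩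

omit [DecidableEq S] in
/-- A multiplicity floor `c ≥ 1` makes the hub list reach every cold level. [ours] -/
theorem hubList_surj_of_mult {c : ℕ} (hc1 : 1 ≤ c) (hc : ∀ k : Fin K, c ≤ (univ.filter (fun r : Fin m => κ r = k)).card)
    (k : Fin K) : ∃ r, κ r = k := by
  have hne : (univ.filter (fun r : Fin m => κ r = k)).Nonempty := by
    rw [← Finset.card_pos]; exact lt_of_lt_of_le (by omega) (hc k)
  obtain ⟨r, hr⟩ := hne
  exact ⟨r, (Finset.mem_filter.mp hr).2⟩

/-- **THE CHAPTER-M SCHEME IS IRREDUCIBLE, WITHOUT THE REGIME** (exact hot sampler, positive laws, `0 < t < 1`, `w ≥ 0`,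
`Σw = 1`, `w_0 > 0`, hub multiplicities `≥ c ≥ 1`, cold updates arbitrary transition matrices, ANY entry maps).  Compare
`dominatedStar_isIrreducible` (M11), which needed `4t ≤ p(1−t)w_0` and one-sided domination. [ours] -/
theorem dominatedStar_isIrreducible_regimeFree (ht0 : 0 < t) (ht1 : t < 1) (hw0 : ∀ k, 0 ≤ w k) (hw00 : 0 < w 0)
    (hw1 : ∑ k, w k = 1) (hμ : ∀ k x, 0 < μ k x) (hM : ∀ k, IsRowStochastic (M k)) (hM0 : ∀ u v, M 0 u v = μ 0 v)
    {c : ℕ} (hc1 : 1 ≤ c) (hc : ∀ p' : Fin K, c ≤ (univ.filter (fun r : Fin m => κ r = p')).card) :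
    Literature.Probability.MarkovChains.IsIrreducible (fun y z : Fin (K + 1) → S =>
        t * ptGraphSwap μ (fun r : Fin m => (((0 : Fin (K + 1)), (κ r).succ) : Fin (K + 1) × Fin (K + 1))) φ y z
          + (1 - t) * prodKernel w M y z) :=
  entryStar_isIrreducible_of_hot κ φ (hubList_surj_of_mult κ hc1 hc) hμ hM (exactSampler_isIrreducible (hμ 0) hM0)
    hw0 hw1 hw00 ht0 ht1

/-! ## §2 Autocorrelation times of every observable, without the regime -/

/-- **`τ_int(g) ≤ 1/(p·min{ct/(3m), γ₀(1−t)w_0/(7K)}) − ½` FOR EVERY OBSERVABLE, NO REGIME** (`K ≥ 1`, `m ≥ 1`, `|S| ≥ 2`; hot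
update `μ_0`-reversible, irreducible, Poincaré constant `γ₀`; cold updates `μ_k`-reversible; one-sided transported domination;
every cold level listed `≥ c ≥ 1` times; `Var_π̃(g) > 0`). [ours] -/
theorem entryStar_tauInt_le [Nontrivial S] (hK : 1 ≤ K) (hm : 1 ≤ m) (hμ : ∀ k x, 0 < μ k x) (hμ1 : ∀ k, ∑ u, μ k u = 1)
    (hM : ∀ k, IsRowStochastic (M k)) (hMrev : ∀ k, DetailedBalance (μ k) (M k))
    (hM0 : Literature.Probability.MarkovChains.IsIrreducible (M 0)) (hw0 : ∀ k, 0 ≤ w k) (hw1 : ∑ k, w k = 1)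
    (hwhot : 0 < w 0) (ht0 : 0 < t) (ht1 : t < 1) {γ₀ : ℝ} (hp : 0 < p) (hp1 : p ≤ 1) (hγ₀ : 0 < γ₀)
    (hdom : ∀ (r : Fin m) (u : S), p * μ (κ r).succ (φ r u) ≤ μ 0 u)
    (hgap0 : ∀ h : S → ℝ, γ₀ * lawVariance (μ 0) h ≤ dirichletForm (μ 0) (M 0) h)
    {c : ℕ} (hc1 : 1 ≤ c) (hc : ∀ k : Fin K, c ≤ (univ.filter (fun r : Fin m => κ r = k)).card)
    {g : (Fin (K + 1) → S) → ℝ} (hg : 0 < lawVariance (tensorFun μ) g) :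
    asympVar g (tensorFun μ) (fun y z : Fin (K + 1) → S =>
        t * ptGraphSwap μ (fun r : Fin m => (((0 : Fin (K + 1)), (κ r).succ) : Fin (K + 1) × Fin (K + 1))) φ y z
          + (1 - t) * prodKernel w M y z) / (2 * lawVariance (tensorFun μ) g)
      ≤ 1 / (p * min (c * t / (3 * m)) (γ₀ * (1 - t) * w 0 / (7 * K))) - 1 / 2 := by
  have hKpos : (0 : ℝ) < K := Nat.cast_pos.mpr (by omega)
  have hmpos : (0 : ℝ) < m := Nat.cast_pos.mpr (by omega)
  have hcpos : (0 : ℝ) < c := Nat.cast_pos.mpr (by omega)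
  have h1t : 0 < 1 - t := by linarith
  have hc0 : 0 < p * min (c * t / (3 * m)) (γ₀ * (1 - t) * w 0 / (7 * K)) :=
    mul_pos hp (lt_min (by positivity) (by positivity))
  exact tauInt_le_of_gapFloor (tensorFun_pos hμ) (sum_tensorFun_eq_one μ hμ1)
    (weightedScheme_isRowStochastic (ptGraphSwap_isRowStochastic hμ) hM hw0 hw1 ht0.le ht1.le)
    (weightedScheme_detailedBalance (ptGraphSwap_detailedBalance hμ) hMrev t)
    (entryStar_isIrreducible_of_hot κ φ (hubList_surj_of_mult κ hc1 hc) hμ hM hM0 hw0 hw1 hwhot ht0 ht1) hc0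
    (entryStar_spectralGap_ge κ φ hK hm hμ hμ1 hM hMrev hw0 hw1 hwhot ht0 ht1 hp hp1 hγ₀ hdom hgap0 hc1 hc) hg

/-- **EXACT HOT SAMPLER: `τ_int(g) ≤ 1/(p·min{ct/(3m), (1−t)w_0/(7K)}) − ½`** for every observable — the hypotheses of M15's
`dominatedStar_tauInt_le` with the regime `4t ≤ p(1−t)w_0` REMOVED (`0 < t < 1`, `w_0 > 0` instead). [ours] -/
theorem dominatedStar_tauInt_le_regimeFree [Nontrivial S] (hK : 1 ≤ K) (hm : 1 ≤ m) (ht0 : 0 < t) (ht1 : t < 1)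
    (hw0 : ∀ k, 0 ≤ w k) (hw00 : 0 < w 0) (hw1 : ∑ k, w k = 1) (hμ : ∀ k x, 0 < μ k x)
    (hμ1 : ∀ k, ∑ u, μ k u = 1) (hM : ∀ k, IsRowStochastic (M k)) (hMrev : ∀ k, DetailedBalance (μ k) (M k))
    (hM0 : ∀ u v, M 0 u v = μ 0 v) (hp0 : 0 < p) (hp1 : p ≤ 1) (hdom : ∀ r u, p * μ (κ r).succ (φ r u) ≤ μ 0 u)
    {c : ℕ} (hc1 : 1 ≤ c) (hc : ∀ p' : Fin K, c ≤ (univ.filter (fun r : Fin m => κ r = p')).card)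
    {g : (Fin (K + 1) → S) → ℝ} (hg : 0 < lawVariance (tensorFun μ) g) :
    asympVar g (tensorFun μ) (fun y z : Fin (K + 1) → S =>
        t * ptGraphSwap μ (fun r : Fin m => (((0 : Fin (K + 1)), (κ r).succ) : Fin (K + 1) × Fin (K + 1))) φ y z
          + (1 - t) * prodKernel w M y z) / (2 * lawVariance (tensorFun μ) g)
      ≤ 1 / (p * min (c * t / (3 * m)) ((1 - t) * w 0 / (7 * K))) - 1 / 2 := by
  have h := entryStar_tauInt_le κ φ hK hm hμ hμ1 hM hMrev (exactSampler_isIrreducible (hμ 0) hM0) hw0 hw1 hw00 ht0 ht1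
    hp0 hp1 one_pos hdom (exactSampler_poincare_one (hμ1 0) hM0) hc1 hc hg
  simpa only [one_mul] using h

/-- **AT THE `p`-INDEPENDENT SWAP FRACTION `t = 1/2`: `τ_int(g) ≤ 1/(p·min{c/(6m), w_0/(14K)}) − ½`** (exact hot sampler).
[ours] -/
theorem dominatedStar_tauInt_le_half [Nontrivial S] (hK : 1 ≤ K) (hm : 1 ≤ m) (hw0 : ∀ k, 0 ≤ w k) (hw00 : 0 < w 0)
    (hw1 : ∑ k, w k = 1) (hμ : ∀ k x, 0 < μ k x) (hμ1 : ∀ k, ∑ u, μ k u = 1) (hM : ∀ k, IsRowStochastic (M k))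
    (hMrev : ∀ k, DetailedBalance (μ k) (M k)) (hM0 : ∀ u v, M 0 u v = μ 0 v) (hp0 : 0 < p) (hp1 : p ≤ 1)
    (hdom : ∀ r u, p * μ (κ r).succ (φ r u) ≤ μ 0 u)
    {c : ℕ} (hc1 : 1 ≤ c) (hc : ∀ p' : Fin K, c ≤ (univ.filter (fun r : Fin m => κ r = p')).card)
    {g : (Fin (K + 1) → S) → ℝ} (hg : 0 < lawVariance (tensorFun μ) g) :
    asympVar g (tensorFun μ) (fun y z : Fin (K + 1) → S =>
        (1 / 2 : ℝ) * ptGraphSwap μ (fun r : Fin m => (((0 : Fin (K + 1)), (κ r).succ) : Fin (K + 1) × Fin (K + 1))) φ y z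
          + (1 - 1 / 2) * prodKernel w M y z) / (2 * lawVariance (tensorFun μ) g)
      ≤ 1 / (p * min ((c : ℝ) / (6 * m)) (w 0 / (14 * K))) - 1 / 2 := by
  have h := dominatedStar_tauInt_le_regimeFree κ φ hK hm (t := 1 / 2) (by norm_num) (by norm_num) hw0 hw00 hw1 hμ hμ1 hM
    hMrev hM0 hp0 hp1 hdom hc1 hc hg
  have e : min ((c : ℝ) / (6 * m)) (w 0 / (14 * K)) = min ((c : ℝ) * (1 / 2) / (3 * m)) ((1 - 1 / 2) * w 0 / (7 * K)) := by
    congr 1 <;> ring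
  rw [e]
  exact h

/-- **UNIFORM LISTING, HOT-ONLY REFRESH WEIGHT, HALF SWAPS: `τ_int(g) ≤ 14K/p − ½` FOR EVERY OBSERVABLE** (`t = 1/2`,
`w_0 = 1`, `m ≤ cK` — e.g. the star list `m = cK`; exact hot sampler, one-sided transports of quality `p`, no regime): OPEN-MATH
item 5, affirmative for autocorrelation times. [ours] -/
theorem uniformStar_tauInt_le_half [Nontrivial S] (hK : 1 ≤ K) (hm : 1 ≤ m) (hw0 : ∀ k, 0 ≤ w k) (hw01 : w 0 = 1)
    (hw1 : ∑ k, w k = 1) (hμ : ∀ k x, 0 < μ k x) (hμ1 : ∀ k, ∑ u, μ k u = 1) (hM : ∀ k, IsRowStochastic (M k))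
    (hMrev : ∀ k, DetailedBalance (μ k) (M k)) (hM0 : ∀ u v, M 0 u v = μ 0 v) (hp0 : 0 < p) (hp1 : p ≤ 1)
    (hdom : ∀ r u, p * μ (κ r).succ (φ r u) ≤ μ 0 u)
    {c : ℕ} (hc1 : 1 ≤ c) (hc : ∀ p' : Fin K, c ≤ (univ.filter (fun r : Fin m => κ r = p')).card)
    (hmcK : (m : ℝ) ≤ c * K) {g : (Fin (K + 1) → S) → ℝ} (hg : 0 < lawVariance (tensorFun μ) g) :
    asympVar g (tensorFun μ) (fun y z : Fin (K + 1) → S =>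
        (1 / 2 : ℝ) * ptGraphSwap μ (fun r : Fin m => (((0 : Fin (K + 1)), (κ r).succ) : Fin (K + 1) × Fin (K + 1))) φ y z
          + (1 - 1 / 2) * prodKernel w M y z) / (2 * lawVariance (tensorFun μ) g)
      ≤ 14 * K / p - 1 / 2 := by
  have hKpos : (0 : ℝ) < K := Nat.cast_pos.mpr (by omega)
  have hmpos : (0 : ℝ) < m := Nat.cast_pos.mpr (by omega)
  have hcpos : (0 : ℝ) < c := Nat.cast_pos.mpr (by omega)
  have h := dominatedStar_tauInt_le_half κ φ hK hm hw0 (by rw [hw01]; exact one_pos) hw1 hμ hμ1 hM hMrev hM0 hp0 hp1 hdom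
    hc1 hc hg
  rw [hw01] at h
  -- `min{c/(6m), 1/(14K)} ≥ 1/(14K)` when `m ≤ cK`
  have hmin : 1 / (14 * (K : ℝ)) ≤ min ((c : ℝ) / (6 * m)) (1 / (14 * K)) := by
    refine le_min ?_ le_rfl
    rw [div_le_div_iff₀ (by positivity) (by positivity)]
    nlinarith
  have hpos : 0 < p * (1 / (14 * (K : ℝ))) := by positivity
  have hle : 1 / (p * min ((c : ℝ) / (6 * m)) (1 / (14 * K))) ≤ 1 / (p * (1 / (14 * K))) :=
    one_div_le_one_div_of_le hpos (mul_le_mul_of_nonneg_left hmin hp0.le)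
  have e : 1 / (p * (1 / (14 * (K : ℝ)))) = 14 * K / p := by
    field_simp
  linarith [h, hle, e.le, e.ge]

end EntryStar

end Summit.Ventures.LatticeQCDFlow.Scaling

end
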